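import Summits.BirchSwinnertonDyer.BirchSwinnertonDyer.Theorems.AlignedTransportAtTwoMainConjectureOfRankZeroBSDAtTwoNarrowCubicNamedInputSignSplit
import Literature.NumberTheory.IwasawaTheory.NarrowDefectBoundedOfClassicalMuOneRealPlace
import Literature.NumberTheory.CubicFields.CubicFieldGaloisIffSquareDiscriminant
import HarnessLib

/-!
# Route `AlignedTransportAtTwo`, crux C2 `MainConjectureOfRankZeroBSDAtTwo` (stmt-BirchSwinnertonDyer-22298):
# THE RESTATEMENT MENU IS ONE STATEMENT — the three W-free named inputs for C2 are KERNEL-EQUIVALENT, and the discriminant currency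

HONEST FRAMING. WIDTH-5 attached prover seat `bsd-line-att-p4` g33 on line `birth` of the lead `bsd-line-att-p2`; `--supports`
stmt-BirchSwinnertonDyer-22298, closes nothing; BSD is NOT proved; crux C2, its verdict «blocked-on `Rank1Residual.GreenbergMuConjectureIrreducible`»
and every registered stub untouched. THEOREMS ONLY (no `def`, no named fact, no `sorry`). The hypotheses compared here are OPEN instances of Iwasawa's
`μ`-conjecture / Greenberg's conjecture in Kida's narrow form for non-abelian cubic fields; nothing is asserted about them — only that they are EQUIVALENT
to one another as stated, W-free, by tree theorems.

* §1 ★★ `narrowMu_nonGalois_cubic_iff_signSplit` — **(i) «∀ non-Galois cubic F: μ₂(F^cyc) = 0 ∧ bounded narrow 2-defect» ⟺ (ii) «∀ non-Galois, not totally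
  real cubic F: μ₂(F^cyc) = 0» ∧ «∀ non-Galois totally real cubic F: μ₂(F^cyc) = 0 ∧ bounded narrow 2-defect»** — `⟸` on complex cubics is this seat's
  Literature theorem `exists_narrowDefect_le_of_classicalMu_of_not_isTotallyReal_cubic` (Iwasawa's quadratic ascent + genus theory backwards, W-free).
* §2 `narrowMu_nonGalois_cubic_iff_nonsquare_discr` — (i) ⟺ (i′) the same binder with `¬ IsSquare (discr F)` in place of `¬ IsGalois ℚ F` (this seat's
  Literature `isGalois_iff_isSquare_discr_cubic`: a cubic field is Galois iff its discriminant is a square).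
* §3 ★★★ `crux_of_forall_cubicField_nonsquare_discr_narrowClassicalMu` — C2 BY NAME from (i′) + PRINT⁵ + MuIneqʳ (discriminant currency).
* §4 ★★ `pointFieldMuCyc_of_forall_nonGalois_cubicField_narrowClassicalMu` — the REGISTERED STUB PFμ⁺ (`PointFieldMuCycAtTwo`, body verbatim) from (i):
  the lead's skeleton (road (b″)) is sorry-free modulo {PRINT⁵, Limʳ, MuIneqʳ} + ONE named conjecture.
Expected REF2 grade COROLLARY-OF-TREE. PARTITION: none; beyond-print theorem: no; BSD is NOT proved by any of this.

References: [Kida1982JFields] Thm. 1, Remark (ii); [Iwasawa1973MuInvariants] Thm. 2/3; [Greenberg2001IwasawaPastPresent] §4; [Cohen1993] §6.3.3;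
[Kato2004Asterisque] Thm. 17.4; [GreenbergLNM1716] Thm. 4.1; tree: `…NarrowCubicNamedInput{,SignSplit}`, `NarrowDefectBoundedOfClassicalMuOneRealPlace`,
`CubicFields/CubicFieldGaloisIffSquareDiscriminant`.
-/

-- the Theorems namespace of this sub repeats the summit name by design (D-0017 nested layout)
set_option linter.dupNamespace false
set_option autoImplicit false

noncomputable section

open scoped NumberField IntermediateField

namespace Summit.BirchSwinnertonDyer.BirchSwinnertonDyer.Theorems.AlignedTransportAtTwoNarrowCubicNamedInputMenu

open NumberField Polynomial WeierstrassCurve IntermediateField Field CongruenceSubgroup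
  Literature.NumberTheory.EllipticCurves Literature.NumberTheory.EllipticCurves.Greenberg1999
  Literature.NumberTheory.EllipticCurves.ModularForms Literature.NumberTheory.EllipticCurves.Rank1Residual
  Literature.NumberTheory.EllipticCurves.Module
  Literature.NumberTheory.EllipticCurves.DokchitserDokchitser2012
  Literature.NumberTheory.EllipticCurves.ZpExtension Literature.NumberTheory.GaloisRepresentations
  Literature.NumberTheory.IwasawaTheory Literature.NumberTheory.NumberFields Literature.NumberTheory.CubicFields
  Summit.BirchSwinnertonDyer.Rank1Residual Summit.BirchSwinnertonDyer.Rank1Residual.X1.MuLambda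
  Summit.BirchSwinnertonDyer.Rank1Residual.X5 Summit.BirchSwinnertonDyer.Rank1Residual.F1Sign2
  Summit.BirchSwinnertonDyer.BirchSwinnertonDyer.Theorems.Rank1ResidualX1Defs
  Summit.BirchSwinnertonDyer.BirchSwinnertonDyer.Theses.AlignedTransportAtTwo
  Summit.BirchSwinnertonDyer.BirchSwinnertonDyer.Theorems.AlignedTransportAtTwoFineRoad.DivisionCubic
  Summit.BirchSwinnertonDyer.BirchSwinnertonDyer.Theorems.AlignedTransportAtTwoPointFieldCarrierCM
  Summit.BirchSwinnertonDyer.BirchSwinnertonDyer.Theorems.AlignedTransportAtTwoPointFieldCarrierCMIff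
  Summit.BirchSwinnertonDyer.BirchSwinnertonDyer.Theorems.AlignedTransportAtTwoNarrowCubicNamedInput
  Summit.BirchSwinnertonDyer.BirchSwinnertonDyer.Theorems.AlignedTransportAtTwoNarrowCubicNamedInputSignSplit

/-! ## §1 (i) one binder ⟺ (ii) the sign-split pair -/

/-- ★★ **THE ONE-BINDER NARROW INPUT ⟺ THE SIGN-SPLIT PAIR** (W-free, kernel): «∀ cubic number field `F` not Galois over `ℚ`: `μ₂ = 0` for every cyclotomic
`ℤ₂`-extension of `F` and bounded narrow `2`-defect along them» ⟺ «∀ such `F` NOT totally real: `μ₂ = 0` for every cyclotomic `ℤ₂`-extension» ∧ «∀ such `F`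
totally real: `μ₂ = 0` and bounded narrow `2`-defect». `⟹` is bookkeeping; `⟸` on the complex cubics is the theorem «one real place: `μ₂ = 0` ⟹ bounded narrow
`2`-defect» (`NarrowDefectBoundedOfClassicalMuOneRealPlace`). Both sides are OPEN IN PRINT; only their equivalence is asserted.
[cite: Kida1982JFields, Thm. 1 (p. 340) and Remark (ii) (p. 341)] [cite: Iwasawa1973MuInvariants, Thm. 2 and Thm. 3, §3–§4] -/
theorem narrowMu_nonGalois_cubic_iff_signSplit :
    (∀ (F : Type) [Field F] [NumberField F], Module.finrank ℚ F = 3 → ¬ IsGalois ℚ F →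
      (∀ κ : ZpExtension F 2, κ.IsCyclotomic → ClassicalMuVanishes κ) ∧
        ∃ D : ℕ, ∀ κ : ZpExtension F 2, κ.IsCyclotomic → ∀ n : ℕ, ∀ [NumberField ↥(κ.layer n)],
          padicValNat 2 (narrowClassNumber ↥(κ.layer n)) ≤ padicValNat 2 (classNumber ↥(κ.layer n)) + D) ↔
    ((∀ (F : Type) [Field F] [NumberField F], Module.finrank ℚ F = 3 → ¬ IsGalois ℚ F → ¬ IsTotallyReal F →
        ∀ κ : ZpExtension F 2, κ.IsCyclotomic → ClassicalMuVanishes κ) ∧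
      ∀ (F : Type) [Field F] [NumberField F], Module.finrank ℚ F = 3 → ¬ IsGalois ℚ F → IsTotallyReal F →
        (∀ κ : ZpExtension F 2, κ.IsCyclotomic → ClassicalMuVanishes κ) ∧
          ∃ D : ℕ, ∀ κ : ZpExtension F 2, κ.IsCyclotomic → ∀ n : ℕ, ∀ [NumberField ↥(κ.layer n)],
            padicValNat 2 (narrowClassNumber ↥(κ.layer n)) ≤ padicValNat 2 (classNumber ↥(κ.layer n)) + D) := by
  refine ⟨signSplit_of_forall_nonGalois_cubicField_narrowClassicalMu, fun ⟨hC, hR⟩ F _ _ hF hG ↦ ?_⟩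
  by_cases hT : IsTotallyReal F
  · exact hR F hF hG hT
  · have hμ := hC F hF hG hT
    exact ⟨hμ, exists_narrowDefect_le_of_classicalMu_of_not_isTotallyReal_cubic F hF hT hμ⟩

/-! ## §2 (i) in `IsGalois` currency ⟺ (i′) in discriminant currency -/

/-- **Non-Galois ⟺ non-square discriminant, for cubic fields** (this seat's Literature `isGalois_iff_isSquare_discr_cubic`), hence the one-binder narrow input
may be written «∀ cubic `F` with `d_F ∉ ℤ²: …». [cite: Cohen1993, §6.3.3] [cite: Kida1982JFields, Remark (ii) (p. 341)] -/
theorem narrowMu_nonGalois_cubic_iff_nonsquare_discr :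
    (∀ (F : Type) [Field F] [NumberField F], Module.finrank ℚ F = 3 → ¬ IsGalois ℚ F →
      (∀ κ : ZpExtension F 2, κ.IsCyclotomic → ClassicalMuVanishes κ) ∧
        ∃ D : ℕ, ∀ κ : ZpExtension F 2, κ.IsCyclotomic → ∀ n : ℕ, ∀ [NumberField ↥(κ.layer n)],
          padicValNat 2 (narrowClassNumber ↥(κ.layer n)) ≤ padicValNat 2 (classNumber ↥(κ.layer n)) + D) ↔
    (∀ (F : Type) [Field F] [NumberField F], Module.finrank ℚ F = 3 → ¬ IsSquare (discr F) →
      (∀ κ : ZpExtension F 2, κ.IsCyclotomic → ClassicalMuVanishes κ) ∧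
        ∃ D : ℕ, ∀ κ : ZpExtension F 2, κ.IsCyclotomic → ∀ n : ℕ, ∀ [NumberField ↥(κ.layer n)],
          padicValNat 2 (narrowClassNumber ↥(κ.layer n)) ≤ padicValNat 2 (classNumber ↥(κ.layer n)) + D) :=
  ⟨fun h F _ _ hF hD ↦ h F hF fun hG ↦ hD ((isGalois_iff_isSquare_discr_cubic F hF).mp hG),
    fun h F _ _ hF hG ↦ h F hF fun hD ↦ hG ((isGalois_iff_isSquare_discr_cubic F hF).mpr hD)⟩

/-! ## §3 The crux by name in discriminant currency -/

/-- ★★★ **«for every cubic number field `F` whose discriminant is NOT a square: `μ₂ = 0` for every cyclotomic `ℤ₂`-extension of `F` and bounded narrow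
`2`-defect» + PRINT⁵ + MuIneqʳ ⟹ C2 BY NAME** (discriminant currency of `…NarrowCubicNamedInput.crux_of_forall_nonGalois_cubicField_narrowClassicalMu`).
CONDITIONAL; the hypothesis is OPEN IN PRINT; the item stays open; BSD is NOT proved. [cite: Greenberg2001IwasawaPastPresent, §4 (Iwasawa's μ = 0 conjecture)]
[cite: Kida1982JFields, Thm. 1 (p. 340) and Remark (ii) (p. 341)] [cite: Kato2004Asterisque, Thm. 17.4 (p. 273) and §17.13 (pp. 279–280)]
[cite: GreenbergLNM1716, Thm. 4.1 (p. 102) and Conj. 1.11 (p. 58)] -/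
theorem crux_of_forall_cubicField_nonsquare_discr_narrowClassicalMu
    (h17 : ∀ (V : WeierstrassCurve ℚ) [V.IsElliptic] [V.IsGloballyMinimal] [NeZero (V.conductorNorm ℤ)]
      (f : CuspForm (Gamma0 (V.conductorNorm ℤ)) 2), kato_divisibility_allPrimes V 2 (f := f))
    (hGr : Greenberg1999.thm41_charValue_rankZero_anyPrime)
    (hper : realPeriodRat_eq_unit_mul_plusPeriod_two) (hmod : nonempty_modularParametrizationData)
    (hGZK : rank_eq_analyticRank_of_analyticRank_le_one)
    (hI : ∀ (W : WeierstrassCurve ℚ) [W.IsElliptic] [W.IsGloballyMinimal], IsOrdinaryAt W 2 →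
      (∀ x : ℚ, ¬ HasRationalTwoTorsionX W x) →
      ∀ (κ : ZpExtension ℚ 2) (γ : Field.absoluteGaloisGroup ℚ), κ.IsCyclotomic →
      κ.IsTopGenerator γ → IsCyclotomicVariable 2 γ →
      ∀ ⦃N : ℕ⦄ [NeZero N] (f : CuspForm (Gamma0 N) 2), IsNewformOf W f →
      ∀ Gp : IwasawaAlgebra 2, iwasawaToPowerSeries 2 Gp = padicLFunction f (unitRoot W 2 : ℚ_[2]) →
      ∀ (D : W.SelmerDualData κ γ) (Yr : W.FineSelmerDualDataRelaxedInf κ γ),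
        lengthAt (IwasawaAlgebra 2) D.X ⟨IwasawaAlgebra.augIdealP 2, IwasawaAlgebra.isPrime_augIdealP_holds 2⟩ ≤
          lengthAt (IwasawaAlgebra 2) (IwasawaAlgebra 2 ⧸ Ideal.span {Gp})
              ⟨IwasawaAlgebra.augIdealP 2, IwasawaAlgebra.isPrime_augIdealP_holds 2⟩ +
            lengthAt (IwasawaAlgebra 2) Yr.X ⟨IwasawaAlgebra.augIdealP 2, IwasawaAlgebra.isPrime_augIdealP_holds 2⟩)
    (hN : ∀ (F : Type) [Field F] [NumberField F], Module.finrank ℚ F = 3 → ¬ IsSquare (discr F) →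
      (∀ κ : ZpExtension F 2, κ.IsCyclotomic → ClassicalMuVanishes κ) ∧
        ∃ D : ℕ, ∀ κ : ZpExtension F 2, κ.IsCyclotomic → ∀ n : ℕ, ∀ [NumberField ↥(κ.layer n)],
          padicValNat 2 (narrowClassNumber ↥(κ.layer n)) ≤ padicValNat 2 (classNumber ↥(κ.layer n)) + D) :
    MainConjectureOfRankZeroBSDAtTwo :=
  crux_of_forall_nonGalois_cubicField_narrowClassicalMu h17 hGr hper hmod hGZK hI (narrowMu_nonGalois_cubic_iff_nonsquare_discr.mpr hN)

/-! ## §4 The registered stub PFμ⁺ from the named input (for the LEAD's skeleton) -/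

/-- ★★ **THE REGISTERED STUB PFμ⁺ (`PointFieldMuCycAtTwo`, body verbatim) FROM THE ONE-BINDER NARROW INPUT.** «∀ non-Galois cubic `F`: `μ₂(F^cyc) = 0` ∧
bounded narrow `2`-defect» ⟹ for every seed-cell `W` (binders of the stub verbatim) and every `i² = −1`: `μ₂ = 0` for every cyclotomic `ℤ₂`-extension of
`ℚ(W[2]) ⊔ ℚ⟮i⟯`. (On the model `ℚ⟮β₀⟯`: not Galois (`…NarrowCubicNamedInput` §1), odd degree; cell `bsd-2adic`'s Kida-lite ascent to `ℚ⟮β₀⟯ ⊔ ℚ⟮i⟯`;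
att-p3 g34's ascent `ℚ(β₀, i) → ℚ(W[2], i)`.) With this the lead's skeleton `Lines/birth.lean` (road (b″): P, Limʳ, MuIneqʳ, PFμ⁺ ⟹ T ⟹ C2) is sorry-free
MODULO {P = PRINT⁵, Limʳ = PRINT, MuIneqʳ = PRINT-pending-typing} and ONE named conjecture. CONDITIONAL; nothing closed; BSD is NOT proved.
[cite: Kida1982JFields, Thm. 1 (p. 340)] [cite: Iwasawa1973MuInvariants, Thm. 2 and Thm. 3, §3–§4] [cite: Greenberg2001IwasawaPastPresent, §4] -/
theorem pointFieldMuCyc_of_forall_nonGalois_cubicField_narrowClassicalMu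
    (hN : ∀ (F : Type) [Field F] [NumberField F], Module.finrank ℚ F = 3 → ¬ IsGalois ℚ F →
      (∀ κ : ZpExtension F 2, κ.IsCyclotomic → ClassicalMuVanishes κ) ∧
        ∃ D : ℕ, ∀ κ : ZpExtension F 2, κ.IsCyclotomic → ∀ n : ℕ, ∀ [NumberField ↥(κ.layer n)],
          padicValNat 2 (narrowClassNumber ↥(κ.layer n)) ≤ padicValNat 2 (classNumber ↥(κ.layer n)) + D) :
    ∀ (W : WeierstrassCurve ℚ) [W.IsElliptic] [W.IsGloballyMinimal], ¬ W.HasCM →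
      IsOrdinaryAt W 2 → (∀ x : ℚ, ¬ HasRationalTwoTorsionX W x) → ¬ IsSquare W.Δ →
      W.analyticRank = 0 → BSDp W 2 →
      ∀ i : AlgebraicClosure ℚ, i ^ 2 = -1 →
      ∀ κL : ZpExtension ↥(W.divisionField 2 ⊔ IntermediateField.adjoin ℚ {i}) 2,
        κL.IsCyclotomic → ClassicalMuVanishes κL := by
  intro W _ _ _ hord ht hsq _ _ i hi κL hκL
  set B : IntermediateField ℚ (AlgebraicClosure ℚ) := ℚ⟮xT W two_ne_zero 0⟯ with hB
  haveI : FiniteDimensional ℚ ↥B := adjoin.finiteDimensional ((AlgebraicClosure.isAlgebraic ℚ).isAlgebraic _).isIntegral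
  haveI : NumberField ↥B := NumberField.mk
  have h3 : Module.finrank ℚ ↥B = 3 := AlignedTransportAtTwoPointFieldCarrierCM.finrank_adjoin_xT_model W ht 0
  obtain ⟨hμ, D, hδ⟩ := hN ↥B h3 (not_isGalois_adjoin_xT W ht hsq 0)
  have hodd : Odd (Module.finrank ℚ ↥B) := by rw [h3]; decide
  have hP : ∀ κP : ZpExtension ↥(B ⊔ IntermediateField.adjoin ℚ ({i} : Set (AlgebraicClosure ℚ))) 2,
      κP.IsCyclotomic → ClassicalMuVanishes κP :=
    classicalMu_sup_adjoin_of_sq_eq_neg_one_of_narrowDefect_le B hodd hi hμ D hδ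
  exact (AlignedTransportAtTwoPointFieldCarrierCMIff.classicalMuVanishes_sup_adjoin_I_iff_pointFieldCM_of_isOrdinaryAt W hord ht hsq hi 0).mpr
    hP κL hκL

end Summit.BirchSwinnertonDyer.BirchSwinnertonDyer.Theorems.AlignedTransportAtTwoNarrowCubicNamedInputMenu

end
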